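import Literature.NumberTheory.DiophantineGeometry.BcgpSwitchExistsModularAbelianSurface
import Literature.NumberTheory.DiophantineGeometry.GenusTwoTwoTorsionS5b
import Literature.NumberTheory.GaloisRepresentations.OrdinaryPDistinguished
import HarnessLib

/-!
# Boxer–Calegari–Gee–Pilloni 2025, Thm. 8.3.2: residually `A₅(b)` abelian surfaces are modular

Topic `Literature/NumberTheory/DiophantineGeometry`. ONE named fact (D-0014), no proof, no new
definition: Theorem 8.3.2 of G. Boxer, F. Calegari, T. Gee, V. Pilloni, *Modularity theorems for
abelian surfaces* (arXiv:2502.20645v1, §8.3) — the `2`-adic ordinary modularity theorem for abelian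
surfaces `A/ℚ` with `A₅(b) ⊆ im ρ̄_{A,2} ⊆ S₅(b)` — in the `GL₄` form used by the proof of their
Thm. 9.5.2 (§1.8.22, §1.8.24, Def. 1.8.25), in the tree's vocabulary. The body is VERBATIM the
hypothesis binder `h₂` of the accepted reduction
`Literature.NumberTheory.DiophantineGeometry.bcgp_switch_exists_modular_abelianSurface_of_lemma942abcd_of_theorem832`
(`BcgpSwitchExistsModularAbelianSurfaceProofs.lean`, Part 11; the same binder as in Part 10),
vendored by the librarian (sweep g26, vend-from-binder, promote event 3449172) because the provefact
seat may not mint named facts (`lint.fact-fanout`). First consumer: that reduction, with the sibling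
fact `bcgp_switchingSurface_exists` (`BcgpSwitchingSurface.lean`, Lemma 9.4.2 (2)(a)–(d)).

## Source and reading

Theorem 8.3.2, verbatim: "Suppose that `A/ℚ` is an abelian surface such that (1) `A₅(b) ⊆
ρ̄_{A,2}(G_ℚ) ⊆ S₅(b)`. (2) The image of complex conjugation has order `2` and lands in `A₅(b)`. (3)
`A` has good ordinary or semistable reduction at `2`, and `ρ_{A,2}|_{G_{ℚ₂}}` is ordinary and
`2`-distinguished. Then `A` is modular. More precisely, there is a weight `2` cuspidal automorphic
representation `π` for `GSp₄/ℚ` which is ordinary at `2`, and satisfies `ρ_{π,p} ≅ ρ_{A,p}` for all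
`p`."

RENDERING (the seat's reading, `…Proofs.lean` Part 10 header). HYPOTHESES on `B : AbelianVariety ℚ`
with `dim B = 2`: (1)–(2) an additive frame `e : B[2](ℚ̄) ≃ (ℤ/2)⁴` in which every `g ∈ G_ℚ` acts by
some `s5bMatrix σ` (image inside `S₅(b) ⊂ S₆ ≅ Sp₄(𝔽₂)`, §8.1, `GenusTwoTwoTorsionS5b.lean`), every
EVEN `σ` occurs (`A₅(b) ⊆` image), and every complex conjugation (`IsComplexConjugation (algebraMap
ℚ ℝ) c`) acts by `s5bMatrix σ` with `σ` a double transposition (the involutions of `A₅`: order `2`,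
in `A₅(b)`); (3) semistable (possibly good) reduction at `2` in Grothendieck's Galois form — inertia
at `2` acts on every `V_ℓ(B)`, `ℓ ≠ 2`, with `(ρ_ℓ(τ) − 1)² = 0` (SGA 7 I, Exp. IX, 3.5) — and every
framed dual `r₂` of `V₂(B)` (`r₂(g) = [g⁻¹]_{b₂}ᵀ`, the paper's `ρ_{A,2}` on `H¹`, §1.8.23) ordinary
and `2`-distinguished at `v ∣ 2` (Def. 1.8.10, `FramedGaloisRep.IsOrdinaryPDistinguishedAt`).
CONCLUSION, in the summit's almost-everywhere `GL₄` form (the weight-2 `π` on `GSp₄` is of general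
type since `ρ_{A,p}` is absolutely irreducible — `A₅(b)` acts absolutely irreducibly on `B[2]`,
Lemma 8.1.2 — and transfers to a cuspidal automorphic representation of `GL₄(𝔸_ℚ)` with `L(s, H¹(A))
= L(s, Π)`, §1.8.22, §1.8.24, Def. 1.8.25): for EVERY prime `p` and every framed dual `r` of
`V_p(B)` in the dual basis of a `ℚ_p`-basis `b`, and every `ι : ℚ̄_p ≃ ℂ` (given the compactness
input `isCompact_glFiniteIntegralLevel 4 ℚ` that the tree's `CuspidalAutomorphicRepData` takes),
there is an L-algebraic cuspidal `π` of `GL₄(𝔸_ℚ)` whose Satake parameters `a_v` satisfy, for all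
but finitely many `v`, `r` unramified at `v` and `det(X − r(Frob_v)) = arithFrobPolyOfSatake ι q_v 1
a_v` (arithmetic Frobenius; the same clause as in `bcgp_switch_exists_modular_abelianSurface`).

What is deliberately NOT here: the `GSp₄` automorphic representation itself and its ordinarity at
`2` (the tree has no `GSp₄` automorphic vocabulary; only the transferred `GL₄` statement is
recorded, exactly what the consumer needs); `ρ_{π,p} ≅ ρ_{A,p}` at the ramified places. The proof
(§§2–8: `2`-adic patching for `GSp₄`, higher Hida theory, classicality, potential modularity of
`A₅(b)` representations, Arthur's transfer) is a theory absent from Mathlib and the tree.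

## References

* [BoxerCalegariGeePilloni2025] G. Boxer, F. Calegari, T. Gee, V. Pilloni, Modularity theorems for
  abelian surfaces, arXiv:2502.20645v1 (2025): Thm. 8.3.2 (§8.3); §1.8.9 with Def. 1.8.10 (ordinary,
  `p`-distinguished); §1.8.22 (transfer `GSp₄ ↔ GL₄`, general type); §1.8.23 (`ρ_{A,p}` on `H¹`);
  §1.8.24 with Def. 1.8.25 (modular); §8.1, Lemma 8.1.2. Numbering = arXiv v1 (all numbered items
  share the subsubsection counter), checked against the arXiv HTML rendering.
* [GrothendieckSGA7IX] A. Grothendieck, Modèles de Néron et monodromie, SGA 7 I, Exp. IX, LNM 288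
  (1972), §3, 3.5.
-/

namespace Literature.NumberTheory.DiophantineGeometry

open CategoryTheory IsDedekindDomain
open scoped NumberField Matrix
open Literature.NumberTheory.GaloisRepresentations Literature.NumberTheory.Automorphic
open Literature.AlgebraicGeometry.Motives (AbelianVariety)

/-- **Boxer–Calegari–Gee–Pilloni 2025, Theorem 8.3.2** (§8.3; `2`-adic ordinary modularity,
residually `A₅(b)`), `GL₄` form. Every abelian surface `B/ℚ` (`AbelianVariety ℚ`, `dim B = 2`) such
that (1)–(2) in some additive frame of `B[2](ℚ̄)` the Galois action is through `S₅(b)` (`s5bMatrix`)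
with every even permutation realised and complex conjugations acting by double transpositions
(`A₅(b) ⊆ im ρ̄_{B,2} ⊆ S₅(b)`, complex conjugation of order `2` in `A₅(b)`), and (3) `B` has
semistable-or-good reduction at `2` in Galois form (`(ρ_ℓ(τ) − 1)² = 0` for inertia `τ` at `2`, all
`ℓ ≠ 2`) with every framed dual of `V₂(B)` ordinary and `2`-distinguished at `v ∣ 2`, is MODULAR:
for every prime `p`, every framed dual `r` of `V_p(B)` and every `ι : ℚ̄_p ≃ ℂ` there is an
L-algebraic cuspidal automorphic representation of `GL₄(𝔸_ℚ)` whose Satake parameters give `det(X −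
r(Frob_v))` at all but finitely many `v`. VERBATIM the binder `h₂` of
`bcgp_switch_exists_modular_abelianSurface_of_lemma942abcd_of_theorem832`.
Users take `(h : bcgp_residuallyA5b_modular_abelianSurface)`.
Named fact (D-0014), not proved in the tree.
[cite: BoxerCalegariGeePilloni2025, Thm. 8.3.2 with §1.8.22 + §1.8.24 + Def. 1.8.25 (modular, transfer to GL₄), Def. 1.8.10, §1.8.23, §8.1, Lemma 8.1.2]
[cite: GrothendieckSGA7IX, Exp. IX §3, 3.5 (semistable reduction in Galois form)] -/
def bcgp_residuallyA5b_modular_abelianSurface : Prop :=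
  ∀ (B : AbelianVariety ℚ), B.dim = 2 →
    (∃ e : B.geomTorsion (2 : ℕ) ≃+ (Fin 4 → ZMod 2),
      (∀ g : Field.absoluteGaloisGroup ℚ, ∃ σ : Equiv.Perm (Fin 5),
          ∀ P : B.geomTorsion (2 : ℕ), e (g • P) = s5bMatrix σ *ᵥ e P) ∧
      (∀ σ : Equiv.Perm (Fin 5), Equiv.Perm.sign σ = 1 →
          ∃ g : Field.absoluteGaloisGroup ℚ,
            ∀ P : B.geomTorsion (2 : ℕ), e (g • P) = s5bMatrix σ *ᵥ e P) ∧
      (∀ c : Field.absoluteGaloisGroup ℚ, IsComplexConjugation (algebraMap ℚ ℝ) c →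
          ∃ σ : Equiv.Perm (Fin 5), σ.cycleType = {2, 2} ∧
            ∀ P : B.geomTorsion (2 : ℕ), e (c • P) = s5bMatrix σ *ᵥ e P)) →
    (∀ (ℓ : ℕ) [Fact ℓ.Prime], ℓ ≠ 2 →
      ∀ v : HeightOneSpectrum (𝓞 ℚ), ((2 : ℕ) : 𝓞 ℚ) ∈ v.asIdeal →
        ∀ τ ∈ absInertia (v.adicCompletion ℚ),
          (B.rationalTateRep ℓ (absGaloisRestrict ℚ (v.adicCompletion ℚ) τ) - 1) ^ 2 = 0) →
    (∀ (b₂ : Module.Basis (Fin 4) ℚ_[2] (B.rationalTateModule 2))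
        (r₂ : FramedGaloisRep ℚ (PadicAlgCl 2) 4),
        (∀ g : Field.absoluteGaloisGroup ℚ,
          (r₂ g).val =
            ((LinearMap.toMatrix b₂ b₂ (B.rationalTateRep 2 g⁻¹)).map
              (algebraMap ℚ_[2] (PadicAlgCl 2))).transpose) →
        ∀ v : HeightOneSpectrum (𝓞 ℚ), ((2 : ℕ) : 𝓞 ℚ) ∈ v.asIdeal →
          r₂.IsOrdinaryPDistinguishedAt v) →
    ∀ (p : ℕ) [Fact p.Prime] (b : Module.Basis (Fin 4) ℚ_[p] (B.rationalTateModule p))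
      (r : FramedGaloisRep ℚ (PadicAlgCl p) 4),
      (∀ g : Field.absoluteGaloisGroup ℚ,
        (r g).val =
          ((LinearMap.toMatrix b b (B.rationalTateRep p g⁻¹)).map
            (algebraMap ℚ_[p] (PadicAlgCl p))).transpose) →
      ∀ (hcpt : isCompact_glFiniteIntegralLevel 4 ℚ) (ι : PadicAlgCl p ≃+* ℂ),
        ∃ π : CuspidalAutomorphicRepData 4 ℚ hcpt, π.1.IsLAlgebraic ∧
          ∀ᶠ v : HeightOneSpectrum (𝓞 ℚ) in Filter.cofinite, ∃ a : Multiset ℂ,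
            π.1.HasSatakeParamAt v a ∧ r.IsUnramifiedAt v ∧
              r.HasFrobCharpolyAt v (arithFrobPolyOfSatake ι v.residueCard 1 a)

end Literature.NumberTheory.DiophantineGeometry
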